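import Summits.Ventures.CertifiedManyBodySolver.Certificates.EmeryCu4O8_kry_NCCO_c3hh_s10x11_S0
import HarnessLib

/-!
# KLDL-R certificate: an exact cluster vector of the open `Cu₄O₈` block (NCCO three-band corner `c3hh`, sector `(10,11)`, `N = 21`) — part S1 (kernel traces of atom classes [0, 1, 3])

HONEST FRAMING: certified energy-window bookkeeping (a hypothesis-free UPPER bound on the three-band ground-state energy density at
`ρ = 21/16` from ONE explicit cluster vector, Ruelle's cluster variational principle as typed in `EmeryThreeBandBlock2x2RayleighCap`);
not a superconductivity verdict; no number of record at an anchor moves. WHAT-THIS-IS-NOT: a floor; a phase word.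

The vector: the integer-rounded (scale `2^16`) lowest eigenvector of `h(θ) = Σ_a θ_a h^G_a` (`h^G_a = hubbardOpenBoxGP 1 12 (cu4o8Tau a) (cu4o8Ups a) (cu4o8Nu a)`)
on the spin sector `(10,11)` of the twelve physical sites of the open `2×2`-cell block (dimension 792; 790 nonzero coefficients), at the coupling vector
`θ = ['129/100', '129/100', '129/100', '129/100', '-18/25', '-18/25', '-18/25', '-18/25', '13/25', '0', '0', '5287/1000', '2249/500', '2249/500']` (NCCO corner `c3hh` of `BLOCK-TABLES-La214v123_v1` = (t_pd ×4, −t_pp ×4, Δ_pd, ε_px, ε_py, U_d, U_px, U_py), cuprate signs),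
stored as a `CoefTree` (search tree over occupation codes, `HubbardOpenBoxCodedRayleigh`). Norm `NN = 4294990222`; the fourteen EXACT integer traces
`S_a = NN·⟨unit, h^G_a unit⟩ = [-7976488232, -5075080070, -7976488232, -5075080070, 3630842094, 4797982174, 1581201240, 3630842094, 28041309580, 31076742541, 31076742541, 10995238080, 13977785743, 13977785743]` (float eigenvalue 36.079940971 eV/cluster; exact Rayleigh quotient 36.079941130; cap 2.2549963 eV/site = 9.019985 eV/CuO₂).
Parts: S0 = the tree + search-tree order / norm / particle number (kernel); S1–S3 = the fourteen traces `CoefTree.sApp` over the hop-list oracles `cu4o8ClusterF a` (kernel, `decide +kernel`);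
F = the assembled table and the consequences (`emeryEnergyDensity_le_of_cu4o8Tree`: for EVERY `θ'`, `e_Emery(θ', 21/16) ≤ (1/16)·Σ_a θ'_a·S_a/NN`; the corner number; the `hT` trace rows,
unit norm and particle number for the `T > 0` Rayleigh-family floor `le_emeryCellPressure_of_rayleighFamily` / `Downfold/EmeryThermalSeam`).
Generator: HOME/hubbard-box-p2/code/rayleigh/ (kit job ray_main.py: scipy eigsh + exact integer forms; emit_kry.py), hubbard-box-p2 g15.
[cite: Ruelle1969, §3.3] [cite: Emery1987, eq. (1)] [cite: LinGubernatis1993, §II]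
-/

noncomputable section

namespace Summit.Ventures.CertifiedManyBodySolver.Certificates

open Matrix Literature.MathematicalPhysics.QuantumLattice OccupationCode OccupationCode.CoefTree ClusterLowerBound InfVolFermionState HubbardWave0

/-- The exact trace of atom class `0` (kernel). [cite: Ruelle1969, §3.3] -/
theorem kry_NCCO_c3hh_s10x11_sApp0 : kry_NCCO_c3hh_s10x11.sApp (cu4o8ClusterF 0) = -7976488232 := by decide +kernel

/-- The exact trace of atom class `1` (kernel). [cite: Ruelle1969, §3.3] -/
theorem kry_NCCO_c3hh_s10x11_sApp1 : kry_NCCO_c3hh_s10x11.sApp (cu4o8ClusterF 1) = -5075080070 := by decide +kernel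

/-- The exact trace of atom class `3` (kernel). [cite: Ruelle1969, §3.3] -/
theorem kry_NCCO_c3hh_s10x11_sApp3 : kry_NCCO_c3hh_s10x11.sApp (cu4o8ClusterF 3) = -5075080070 := by decide +kernel

end Summit.Ventures.CertifiedManyBodySolver.Certificates

end
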